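import Mathlib.Analysis.SpecificLimits.Normed
import Literature.Computability.AlgebraicComplexity.PrattTripartitionRank
import HarnessLib

/-!
# `TripartitionDarkness` (stmt-MatrixMultiplication-18398): the provable range, the flattening
# ceiling, and the conditional closure

Route `MatrixMultiplication/FidelityWitnesses`; the item (LOWER piece of the split of the crux
`FidelityThesis`) asks, UNCONDITIONALLY, for the conclusion of Pratt's Corollary 1.11
(tree named fact `Literature.Computability.AlgebraicComplexity.pratt2024_cor_1_11`, whose
hypothesis is the Set Cover Conjecture):

  `S : ∀ ε : ℝ, 0 < ε → ε < 8 → ∃ k₀ : ℕ, ∀ k : ℕ, k₀ ≤ k → (8 - ε) ^ k < R̃(T_k)`,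

`T_k = tripartitionTensor ℂ k` Pratt's balanced tripartitioning tensor of format `binom(3k,k)`
(`≈ 6.75^k`) per leg, `R̃` the asymptotic rank.  `S` says `R̃(T_k)^{1/k} → 8`, i.e. `T_k` is an
explicit counterexample family to Strassen's asymptotic rank conjecture; its only support in print
is conditional (SCC ⟹ `S`, Pratt 2024 Cor. 1.11), and every known lower-bound method for `R̃`
(points of the asymptotic spectrum) is capped by the flattening ranks, here `binom(3k,k)`.

This helper file records what IS kernel-provable today, with the item's statement written out
verbatim (the decl `TripartitionDarkness` is not rendered in the route file at rev 7):

* `tripartitionDarkness_pow_le_choose` — `27^k ≤ (3k+1) · 4^k · binom(3k,k)` and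
  `tripartitionDarkness_choose_le_pow` — `4^k · binom(3k,k) ≤ 27^k`: the proved floor
  `binom(3k,k) ≤ R̃(T_k)` (`choose_le_asymptoticRank_tripartitionTensor`) has rate EXACTLY
  `27/4 = 8 − 5/4`;
* `tripartitionDarkness_eventually_pow_lt` — UNCONDITIONALLY every base `b` with `|b| < 27/4` is
  eventually beaten: `∃ k₀, ∀ k ≥ k₀, b^k < R̃(T_k)`;
* `tripartitionDarkness_of_five_fourths_lt` — hence the item's statement holds verbatim on the
  sub-range `5/4 < ε < 8`; the OPEN part of the item is exactly `0 < ε ≤ 5/4`;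
* `tripartitionDarkness_flatteningRank_le` — and on that part the flattening certificate is
  exhausted: `ζ(T_k) = binom(3k,k) ≤ (27/4)^k = (8 − 5/4)^k` for every `k`;
* `tripartitionDarkness_of_setCoverConjecture` — the conditional closure
  `pratt2024_cor_1_11 → SetCoverConjecture → S` (both tree `Prop`s as hypotheses).
  Contrapositively, a refutation of the item would, through Pratt's theorem, refute the Set Cover
  Conjecture: `¬ S` is at least as hard as `¬ SCC`, and `S` needs a point of the asymptotic
  spectrum beyond the flattening value at an explicit tensor — both open.

References: K. Pratt, STOC 2024 (arXiv:2311.02774), Def. 1.4, Prop. 2.1, Cor. 1.11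
[Pratt2024SCC]; Christandl–Vrana–Zuiddam, JAMS 2023, Ex. 1.4 (flattening ranks `≤ R̃`).
-/

-- the tree's namespace `Summit.MatrixMultiplication.MatrixMultiplication.…` repeats a component by design
set_option linter.dupNamespace false

noncomputable section

namespace Summit.MatrixMultiplication.MatrixMultiplication.Theorems

open Filter
open Literature.Computability.AlgebraicComplexity

/-! ## Binomial arithmetic: `binom(3k,k)` has rate `27/4` -/

/-- `binom(3k,k) · (k! · (2k)!) = (3k)!` (the factorial form of the binomial coefficient).
[folklore] -/
theorem tripartitionDarkness_choose_mul_factorial (k : ℕ) :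
    (3 * k).choose k * (k.factorial * (2 * k).factorial) = (3 * k).factorial := by
  have h := Nat.choose_mul_factorial_mul_factorial (show k ≤ 3 * k by omega)
  rw [show 3 * k - k = 2 * k by omega] at h
  rw [← mul_assoc]
  exact h

/-- `(3(k+1))! = (3k+3)(3k+2)(3k+1) · (3k)!`. [folklore] -/
theorem tripartitionDarkness_factorial_three_mul_succ (k : ℕ) :
    (3 * (k + 1)).factorial = (3 * k + 3) * (3 * k + 2) * (3 * k + 1) * (3 * k).factorial := by
  rw [show 3 * (k + 1) = 3 * k + 2 + 1 by ring, Nat.factorial_succ,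
    show 3 * k + 2 = 3 * k + 1 + 1 by ring, Nat.factorial_succ, Nat.factorial_succ]
  ring

/-- `(2(k+1))! = (2k+2)(2k+1) · (2k)!`. [folklore] -/
theorem tripartitionDarkness_factorial_two_mul_succ (k : ℕ) :
    (2 * (k + 1)).factorial = (2 * k + 2) * (2 * k + 1) * (2 * k).factorial := by
  rw [show 2 * (k + 1) = 2 * k + 1 + 1 by ring, Nat.factorial_succ, Nat.factorial_succ]
  ring

/-- **Lower bound** `27^k ≤ (3k+1) · 4^k · binom(3k,k)`: `binom(3k,k) (1/3)^k (2/3)^{2k}` is the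
largest of the `3k+1` terms of `(1/3 + 2/3)^{3k} = 1`; proved by the ratio
`binom(3k+3,k+1)/binom(3k,k) = (3k+3)(3k+2)(3k+1)/((k+1)(2k+2)(2k+1))` against `27/4 · (3k+1)/(3k+4)`.
[folklore] -/
theorem tripartitionDarkness_pow_le_choose (k : ℕ) :
    27 ^ k ≤ (3 * k + 1) * 4 ^ k * (3 * k).choose k := by
  induction k with
  | zero => simp
  | succ n ih =>
    have hf := tripartitionDarkness_choose_mul_factorial
    have hpos : 0 < (n + 1).factorial * (2 * (n + 1)).factorial := by positivity
    refine Nat.le_of_mul_le_mul_right ?_ hpos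
    -- multiply the induction hypothesis by `n! (2n)!` and use the factorial form
    have ih' : 27 ^ n * (n.factorial * (2 * n).factorial) ≤
        (3 * n + 1) * 4 ^ n * (3 * n).factorial := by
      calc 27 ^ n * (n.factorial * (2 * n).factorial)
          ≤ (3 * n + 1) * 4 ^ n * (3 * n).choose n * (n.factorial * (2 * n).factorial) :=
            Nat.mul_le_mul_right _ ih
        _ = (3 * n + 1) * 4 ^ n * ((3 * n).choose n * (n.factorial * (2 * n).factorial)) := by
            ring
        _ = (3 * n + 1) * 4 ^ n * (3 * n).factorial := by rw [hf n]
    have key : 27 * ((n + 1) * ((2 * n + 2) * (2 * n + 1))) * ((3 * n + 1) * 4 ^ n) ≤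
        (3 * n + 4) * 4 * ((3 * n + 3) * (3 * n + 2) * (3 * n + 1)) * 4 ^ n := by
      have h4 : 0 < 4 ^ n := by positivity
      have poly : 27 * ((n + 1) * ((2 * n + 2) * (2 * n + 1))) * (3 * n + 1) ≤
          (3 * n + 4) * 4 * ((3 * n + 3) * (3 * n + 2) * (3 * n + 1)) := by
        have : 27 * ((n + 1) * ((2 * n + 2) * (2 * n + 1))) ≤
            (3 * n + 4) * 4 * ((3 * n + 3) * (3 * n + 2)) := by nlinarith
        calc 27 * ((n + 1) * ((2 * n + 2) * (2 * n + 1))) * (3 * n + 1)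
            ≤ (3 * n + 4) * 4 * ((3 * n + 3) * (3 * n + 2)) * (3 * n + 1) :=
              Nat.mul_le_mul_right _ this
          _ = (3 * n + 4) * 4 * ((3 * n + 3) * (3 * n + 2) * (3 * n + 1)) := by ring
      calc 27 * ((n + 1) * ((2 * n + 2) * (2 * n + 1))) * ((3 * n + 1) * 4 ^ n)
          = 27 * ((n + 1) * ((2 * n + 2) * (2 * n + 1))) * (3 * n + 1) * 4 ^ n := by ring
        _ ≤ (3 * n + 4) * 4 * ((3 * n + 3) * (3 * n + 2) * (3 * n + 1)) * 4 ^ n :=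
              Nat.mul_le_mul_right _ poly
    calc 27 ^ (n + 1) * ((n + 1).factorial * (2 * (n + 1)).factorial)
        = 27 * ((n + 1) * ((2 * n + 2) * (2 * n + 1))) *
            (27 ^ n * (n.factorial * (2 * n).factorial)) := by
          rw [Nat.factorial_succ n, tripartitionDarkness_factorial_two_mul_succ, pow_succ]
          ring
      _ ≤ 27 * ((n + 1) * ((2 * n + 2) * (2 * n + 1))) *
            ((3 * n + 1) * 4 ^ n * (3 * n).factorial) := Nat.mul_le_mul_left _ ih'
      _ = 27 * ((n + 1) * ((2 * n + 2) * (2 * n + 1))) * ((3 * n + 1) * 4 ^ n) *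
            (3 * n).factorial := by ring
      _ ≤ (3 * n + 4) * 4 * ((3 * n + 3) * (3 * n + 2) * (3 * n + 1)) * 4 ^ n *
            (3 * n).factorial := Nat.mul_le_mul_right _ key
      _ = (3 * (n + 1) + 1) * 4 ^ (n + 1) *
            ((3 * (n + 1)).choose (n + 1) * ((n + 1).factorial * (2 * (n + 1)).factorial)) := by
          rw [hf (n + 1), tripartitionDarkness_factorial_three_mul_succ, pow_succ]
          ring
      _ = (3 * (n + 1) + 1) * 4 ^ (n + 1) * (3 * (n + 1)).choose (n + 1) *
            ((n + 1).factorial * (2 * (n + 1)).factorial) := by ring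

/-- **Upper bound** `4^k · binom(3k,k) ≤ 27^k` (one term of `(1 + 2)^{3k}`, or the same ratio
against `27/4`). [folklore] -/
theorem tripartitionDarkness_choose_le_pow (k : ℕ) :
    4 ^ k * (3 * k).choose k ≤ 27 ^ k := by
  induction k with
  | zero => simp
  | succ n ih =>
    have hf := tripartitionDarkness_choose_mul_factorial
    have hpos : 0 < (n + 1).factorial * (2 * (n + 1)).factorial := by positivity
    refine Nat.le_of_mul_le_mul_right ?_ hpos
    have ih' : 4 ^ n * (3 * n).factorial ≤ 27 ^ n * (n.factorial * (2 * n).factorial) := by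
      calc 4 ^ n * (3 * n).factorial
          = 4 ^ n * (3 * n).choose n * (n.factorial * (2 * n).factorial) := by
            rw [← hf n]; ring
        _ ≤ 27 ^ n * (n.factorial * (2 * n).factorial) := Nat.mul_le_mul_right _ ih
    have poly : 4 * ((3 * n + 3) * (3 * n + 2) * (3 * n + 1)) ≤
        27 * ((n + 1) * ((2 * n + 2) * (2 * n + 1))) := by nlinarith
    calc 4 ^ (n + 1) * (3 * (n + 1)).choose (n + 1) *
          ((n + 1).factorial * (2 * (n + 1)).factorial)
        = 4 ^ (n + 1) * ((3 * (n + 1)).choose (n + 1) *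
          ((n + 1).factorial * (2 * (n + 1)).factorial)) := by ring
      _ = 4 * ((3 * n + 3) * (3 * n + 2) * (3 * n + 1)) * (4 ^ n * (3 * n).factorial) := by
          rw [hf (n + 1), tripartitionDarkness_factorial_three_mul_succ, pow_succ]
          ring
      _ ≤ 4 * ((3 * n + 3) * (3 * n + 2) * (3 * n + 1)) *
            (27 ^ n * (n.factorial * (2 * n).factorial)) := Nat.mul_le_mul_left _ ih'
      _ = 4 * ((3 * n + 3) * (3 * n + 2) * (3 * n + 1)) * 27 ^ n *
            (n.factorial * (2 * n).factorial) := by ring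
      _ ≤ 27 * ((n + 1) * ((2 * n + 2) * (2 * n + 1))) * 27 ^ n *
            (n.factorial * (2 * n).factorial) := by gcongr
      _ = 27 ^ (n + 1) * ((n + 1).factorial * (2 * (n + 1)).factorial) := by
          rw [Nat.factorial_succ n, tripartitionDarkness_factorial_two_mul_succ, pow_succ]
          ring

/-- Real form of the lower bound: `(27/4)^k ≤ (3k+1) · binom(3k,k)`. [folklore] -/
theorem tripartitionDarkness_rate_pow_le_choose (k : ℕ) :
    (27 / 4 : ℝ) ^ k ≤ (3 * k + 1) * ((3 * k).choose k : ℝ) := by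
  have h := tripartitionDarkness_pow_le_choose k
  have h' : (27 : ℝ) ^ k ≤ (3 * k + 1) * 4 ^ k * ((3 * k).choose k : ℝ) := by exact_mod_cast h
  have h4 : (0 : ℝ) < 4 ^ k := by positivity
  rw [div_pow, div_le_iff₀ h4]
  calc (27 : ℝ) ^ k ≤ (3 * k + 1) * 4 ^ k * ((3 * k).choose k : ℝ) := h'
    _ = (3 * k + 1) * ((3 * k).choose k : ℝ) * 4 ^ k := by ring

/-- Real form of the upper bound: `binom(3k,k) ≤ (27/4)^k`. [folklore] -/
theorem tripartitionDarkness_choose_le_rate_pow (k : ℕ) :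
    ((3 * k).choose k : ℝ) ≤ (27 / 4 : ℝ) ^ k := by
  have h := tripartitionDarkness_choose_le_pow k
  have h' : (4 : ℝ) ^ k * ((3 * k).choose k : ℝ) ≤ 27 ^ k := by exact_mod_cast h
  have h4 : (0 : ℝ) < 4 ^ k := by positivity
  rw [div_pow, le_div_iff₀ h4]
  calc ((3 * k).choose k : ℝ) * 4 ^ k = 4 ^ k * ((3 * k).choose k : ℝ) := by ring
    _ ≤ 27 ^ k := h'

/-! ## Unconditional darkness up to the flattening rate `27/4` -/

/-- **Every base below the flattening rate is eventually beaten, unconditionally**: if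
`|b| < 27/4` then `b^k < R̃(T_k)` for all large `k` — from `binom(3k,k) ≤ R̃(T_k)`
(`choose_le_asymptoticRank_tripartitionTensor`, conciseness + CVZ Ex. 1.4),
`(27/4)^k ≤ (3k+1) binom(3k,k)` and `(3k+1) (4|b|/27)^k → 0`. [folklore] -/
theorem tripartitionDarkness_eventually_pow_lt {b : ℝ} (hb : |b| < 27 / 4) :
    ∃ k₀ : ℕ, ∀ k : ℕ, k₀ ≤ k → b ^ k < asymptoticRank (tripartitionTensor ℂ k) := by
  -- the ratio `r = |b| / (27/4)` lies in `[0, 1)`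
  set r : ℝ := |b| / (27 / 4) with hr
  have hr0 : 0 ≤ r := div_nonneg (abs_nonneg b) (by norm_num)
  have hr1 : r < 1 := (div_lt_one (by norm_num)).2 hb
  -- `(3k+1) r^k → 0`, so eventually `(3k+1) r^k < 1`
  have h1 : Tendsto (fun k : ℕ => (k : ℝ) * r ^ k) atTop (nhds 0) :=
    tendsto_self_mul_const_pow_of_lt_one hr0 hr1
  have h2 : Tendsto (fun k : ℕ => r ^ k) atTop (nhds 0) :=
    tendsto_pow_atTop_nhds_zero_of_lt_one hr0 hr1
  have h3 : Tendsto (fun k : ℕ => 3 * ((k : ℝ) * r ^ k) + r ^ k) atTop (nhds (3 * 0 + 0)) :=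
    (h1.const_mul 3).add h2
  rw [mul_zero, add_zero] at h3
  have hev : ∀ᶠ k : ℕ in atTop, 3 * ((k : ℝ) * r ^ k) + r ^ k < 1 :=
    h3 (Iio_mem_nhds one_pos)
  obtain ⟨k₀, hk₀⟩ := eventually_atTop.1 hev
  refine ⟨k₀, fun k hk => ?_⟩
  have hsmall : (3 * (k : ℝ) + 1) * r ^ k < 1 := by
    have := hk₀ k hk
    linarith [this]
  -- unfold `r^k = |b|^k / (27/4)^k` and chain the inequalities
  have hq : (0 : ℝ) < (27 / 4 : ℝ) ^ k := by positivity
  have hrk : r ^ k = |b| ^ k / (27 / 4 : ℝ) ^ k := by rw [hr, div_pow]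
  have hlt : (3 * (k : ℝ) + 1) * |b| ^ k < (27 / 4 : ℝ) ^ k := by
    rw [hrk, ← mul_div_assoc, div_lt_one hq] at hsmall
    exact hsmall
  have hpoly : (0 : ℝ) < 3 * (k : ℝ) + 1 := by positivity
  calc b ^ k ≤ |b| ^ k := by rw [← abs_pow]; exact le_abs_self _
    _ < (27 / 4 : ℝ) ^ k / (3 * (k : ℝ) + 1) := by
        rw [lt_div_iff₀ hpoly, mul_comm]; exact hlt
    _ ≤ ((3 * k).choose k : ℝ) := by
        rw [div_le_iff₀ hpoly, mul_comm]
        exact_mod_cast tripartitionDarkness_rate_pow_le_choose k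
    _ ≤ asymptoticRank (tripartitionTensor ℂ k) := choose_le_asymptoticRank_tripartitionTensor ℂ k

/-- **The item's statement on the provable sub-range `5/4 < ε < 8`** (verbatim shape of
`TripartitionDarkness`, with the extra hypothesis `5/4 < ε`): there `0 < 8 − ε < 27/4`, the
flattening rate.  The complementary range `0 < ε ≤ 5/4` is the open problem. [folklore] -/
theorem tripartitionDarkness_of_five_fourths_lt :
    ∀ ε : ℝ, 5 / 4 < ε → ε < 8 → ∃ k₀ : ℕ, ∀ k : ℕ, k₀ ≤ k →
      ((8 : ℝ) - ε) ^ k < asymptoticRank (tripartitionTensor ℂ k) := by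
  intro ε hε hε8
  exact tripartitionDarkness_eventually_pow_lt (abs_lt.2 ⟨by linarith, by linarith⟩)

/-! ## The flattening certificate is exhausted at `ε = 5/4` -/

/-- **Flattening ceiling**: the flattening rank of `T_k` — the quantity behind the proved floor
`binom(3k,k) ≤ R̃(T_k)`, and an upper bound for every known point of the asymptotic spectrum at
`T_k` up to the choice of leg — satisfies `ζ(T_k) = binom(3k,k) ≤ (27/4)^k = (8 − 5/4)^k` for EVERY
`k`; so no `ε ≤ 5/4` instance of the item follows from flattening. [folklore] -/
theorem tripartitionDarkness_flatteningRank_le (k : ℕ) :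
    (flatteningRank (tripartitionTensor ℂ k) : ℝ) ≤ ((8 : ℝ) - 5 / 4) ^ k := by
  rw [flatteningRank_tripartitionTensor, show (8 : ℝ) - 5 / 4 = 27 / 4 by norm_num]
  exact tripartitionDarkness_choose_le_rate_pow k

/-! ## Conditional closure: the item is exactly Pratt's Cor. 1.11 without its hypothesis -/

/-- **`pratt2024_cor_1_11 → SetCoverConjecture → TripartitionDarkness`** (the item's statement
verbatim as conclusion; both hypotheses are tree `Prop`s: Pratt's Cor. 1.11 as a named fact and
the Set Cover Conjecture of Cygan et al.).  This is the entire published evidence for the item.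
[cite: Pratt2024SCC, Cor. 1.11] -/
theorem tripartitionDarkness_of_setCoverConjecture (h : pratt2024_cor_1_11)
    (hscc : Literature.Computability.FineGrained.SetCoverConjecture) :
    ∀ ε : ℝ, 0 < ε → ε < 8 → ∃ k₀ : ℕ, ∀ k : ℕ, k₀ ≤ k →
      ((8 : ℝ) - ε) ^ k < asymptoticRank (tripartitionTensor ℂ k) :=
  h hscc

end Summit.MatrixMultiplication.MatrixMultiplication.Theorems

end
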